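import Summits.Ventures.Crystal3D.Theorems.StickyWulffConstantPolycrystalWulffBoundRadialMass

/-!
# `PolycrystalWulffBound`, line `PolyDensity`: TWO-SHELL ENVELOPES of the cap profile of the crux's
# Wulff body (crux `stmt-Ventures-19482`; input of the generic cdf shift `3/5`, thread L-2)

Route `StickyWulffConstant` of the venture `Summits/Ventures/Crystal3D`, second prover lane (poly-p2,
gen 15).  Split `W(X)` into the full inner ball `B̄(0,√3)`, the shell piece
`W(X) ∩ B̄(0,2) ∖ B̄(0,√3)` (mass `≥ π(20√3 − 32)`, by `volume_cruxWulffBody_inter_closedBall_two_ge`)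
and the remainder `W(X) ∖ B̄(0,2)` (mass `≤ 32 − π(24√3 − 32)`); on each symmetric piece the part
above a level `q ≥ 0` is at most half (it is disjoint from its antipode) and at least half of
(mass − band `{|⟪y,n⟫| ≤ q}`).  With the ball caps `cap_R(q) = π(2R³/3 − R²q + q³/3)`:

* `volume_cruxWulffBody_cap_le_shell` : `|W(X) ∩ {q < ⟪y,n⟫}| ≤ cap₂(q) + (16 + 16π − 12π√3)`, `0 ≤ q ≤ 2`;
* `volume_cruxWulffBody_cap_ge_shell` : `|W(X) ∩ {q < ⟪y,n⟫}| ≥ cap₂(q) − π(64/3 − 12√3)`, `0 ≤ q ≤ √3`,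

for EVERY frame `X` and unit `n`.  Numerically these two-shell envelopes certify a generic cdf shift
`0.558`; finer shells converge to the sharp `√5 − √3 = 0.504` (memo P-L2-g15 §2); the kernel
consumer is `cruxWulffBody_cap_shift_three_fifths` (`…GenericShiftThreeFifths`).
WHAT THIS IS NOT: the sharp constant; the crux is not claimed.
-/

noncomputable section

open scoped BigOperators InnerProductSpace ENNReal Pointwise
open MeasureTheory Set

namespace Summit.Ventures.Crystal3D.Theorems

open Summit.Ventures.Crystal3D.Cruxes.TextureLiminf.TexShadow (E3)

open Literature.MathematicalPhysics.StatisticalMechanics (fccStacking)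

/-! ### The two-shell envelopes of the cap profile -/

/-- **Upper shell envelope.** For every frame `X`, unit `n` and `0 ≤ q ≤ 2`:
`|W(X) ∩ {q < ⟪y,n⟫}| ≤ cap₂(q) + (16 + 16π − 12π√3)`, where `cap₂(q) = π(16/3 − 4q + q³/3)` is the
cap of `B̄(0,2)` and `16 + 16π − 12π√3 = (32 − π(24√3 − 32))/2 ≈ 0.97` is half the mass of `W(X)`
outside `B̄(0,2)` (the part above a nonnegative level is at most half, by central symmetry). -/
theorem volume_cruxWulffBody_cap_le_shell (X : E3 ≃ₗᵢ[ℝ] E3) {n : E3} (hn : ‖n‖ = 1) {q : ℝ}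
    (hq0 : 0 ≤ q) (hq2 : q ≤ 2) :
    volume ({y : E3 | ∀ ν : E3, ⟪y, ν⟫_ℝ ≤ Real.sqrt 2 / 4 *
        ∑ᶠ w ∈ {w | w ∈ fccStacking 1 (Real.sqrt (2 / 3)) ∧ ‖w‖ = 1}, |⟪w, X.symm ν⟫_ℝ|} ∩
        {y : E3 | q < ⟪y, n⟫_ℝ}) ≤
      ENNReal.ofReal (Real.pi * (16 / 3 - 4 * q + q ^ 3 / 3) +
        (16 + 16 * Real.pi - 12 * Real.pi * Real.sqrt 3)) := by
  set body : Set E3 := {y : E3 | ∀ ν : E3, ⟪y, ν⟫_ℝ ≤ Real.sqrt 2 / 4 *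
    ∑ᶠ w ∈ {w | w ∈ fccStacking 1 (Real.sqrt (2 / 3)) ∧ ‖w‖ = 1}, |⟪w, X.symm ν⟫_ℝ|} with hbody
  have hWm : MeasurableSet body := (isCompact_cruxWulffBody X).isClosed.measurableSet
  have hWneg : -body = body := neg_cruxWulffBody_eq X
  have hWvol : volume body = ENNReal.ofReal 32 := volume_cruxWulffBody X
  set B2 : Set E3 := Metric.closedBall (0 : E3) 2 with hB2
  have hB2m : MeasurableSet B2 := Metric.isClosed_closedBall.measurableSet
  set S : Set E3 := body \ B2 with hS
  have hSm : MeasurableSet S := hWm.diff hB2m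
  have hSneg : -S = S := by
    ext y
    simp only [hS, Set.mem_neg, mem_sdiff, hB2, Metric.mem_closedBall, dist_zero_right, norm_neg]
    constructor
    · rintro ⟨hy, hb⟩
      exact ⟨by have h2 : y ∈ -body := hy; rwa [hWneg] at h2, hb⟩
    · rintro ⟨hy, hb⟩
      exact ⟨by rw [← hWneg] at hy; exact hy, hb⟩
  -- split the cap
  have hsplit : body ∩ {y : E3 | q < ⟪y, n⟫_ℝ} ⊆ (B2 ∩ {y : E3 | q < ⟪y, n⟫_ℝ}) ∪ (S ∩ {y : E3 | q < ⟪y, n⟫_ℝ}) := by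
    rintro y ⟨hy, hq⟩
    by_cases hb : y ∈ B2
    · exact Or.inl ⟨hb, hq⟩
    · exact Or.inr ⟨⟨hy, hb⟩, hq⟩
  have hcap : volume (B2 ∩ {y : E3 | q < ⟪y, n⟫_ℝ}) =
      ENNReal.ofReal (Real.pi * (2 * 2 ^ 3 / 3 - 2 ^ 2 * q + q ^ 3 / 3)) :=
    volume_closedBall_inter_ioi hn two_pos hq2 (by linarith)
  have ecap : Real.pi * (2 * 2 ^ 3 / 3 - 2 ^ 2 * q + q ^ 3 / 3) = Real.pi * (16 / 3 - 4 * q + q ^ 3 / 3) := by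
    ring
  rw [ecap] at hcap
  -- the mass outside `B̄(0,2)`
  have hSvol : volume S ≤ ENNReal.ofReal (32 - Real.pi * (24 * Real.sqrt 3 - 32)) := by
    have hsub : body ∩ B2 ⊆ body := inter_subset_left
    have hfin : volume (body ∩ B2) ≠ ⊤ :=
      (lt_of_le_of_lt (measure_mono hsub) (by rw [hWvol]; exact ENNReal.ofReal_lt_top)).ne
    have hdiff : S = body \ (body ∩ B2) := by rw [hS, Set.sdiff_self_inter]
    have h3lo : (1.732 : ℝ) < Real.sqrt 3 := by rw [Real.lt_sqrt (by norm_num)]; norm_num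
    have hm2 : 0 ≤ Real.pi * (24 * Real.sqrt 3 - 32) := mul_nonneg Real.pi_pos.le (by linarith)
    rw [hdiff, measure_sdiff hsub (hWm.inter hB2m).nullMeasurableSet hfin, hWvol,
      ENNReal.ofReal_sub _ hm2]
    exact tsub_le_tsub_left (volume_cruxWulffBody_inter_closedBall_two_ge X) _
  have hShalf : volume (S ∩ {y : E3 | q < ⟪y, n⟫_ℝ}) ≤
      ENNReal.ofReal (16 + 16 * Real.pi - 12 * Real.pi * Real.sqrt 3) := by
    have h2 := (two_mul_volume_inter_ioi_le_of_symm hSneg hSm n hq0).trans hSvol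
    have h3lo : (1.732 : ℝ) < Real.sqrt 3 := by rw [Real.lt_sqrt (by norm_num)]; norm_num
    have h3hi : Real.sqrt 3 < (1.7321 : ℝ) := by rw [Real.sqrt_lt' (by norm_num)]; norm_num
    have hc0 : 0 ≤ 16 + 16 * Real.pi - 12 * Real.pi * Real.sqrt 3 := by
      nlinarith [Real.pi_gt_d2, Real.pi_lt_d2, Real.pi_pos]
    have he : ENNReal.ofReal (32 - Real.pi * (24 * Real.sqrt 3 - 32)) =
        2 * ENNReal.ofReal (16 + 16 * Real.pi - 12 * Real.pi * Real.sqrt 3) := by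
      rw [show (2 : ℝ≥0∞) = ENNReal.ofReal 2 by norm_num, ← ENNReal.ofReal_mul (by norm_num)]
      congr 1; ring
    rw [he] at h2
    exact (ENNReal.mul_le_mul_iff_right two_ne_zero ENNReal.ofNat_ne_top).1 h2
  have hcap0 : 0 ≤ Real.pi * (16 / 3 - 4 * q + q ^ 3 / 3) := by
    have : 0 ≤ 16 / 3 - 4 * q + q ^ 3 / 3 := by nlinarith [sq_nonneg (2 - q)]
    exact mul_nonneg Real.pi_pos.le this
  have hm0 : 0 ≤ 16 + 16 * Real.pi - 12 * Real.pi * Real.sqrt 3 := by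
    have h3hi : Real.sqrt 3 < (1.7321 : ℝ) := by rw [Real.sqrt_lt' (by norm_num)]; norm_num
    nlinarith [Real.pi_lt_d2, Real.pi_pos]
  calc volume (body ∩ {y : E3 | q < ⟪y, n⟫_ℝ})
      ≤ volume (B2 ∩ {y : E3 | q < ⟪y, n⟫_ℝ}) + volume (S ∩ {y : E3 | q < ⟪y, n⟫_ℝ}) :=
        (measure_mono hsplit).trans (measure_union_le _ _)
    _ ≤ ENNReal.ofReal (Real.pi * (16 / 3 - 4 * q + q ^ 3 / 3)) +
        ENNReal.ofReal (16 + 16 * Real.pi - 12 * Real.pi * Real.sqrt 3) :=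
        add_le_add hcap.le hShalf
    _ = ENNReal.ofReal (Real.pi * (16 / 3 - 4 * q + q ^ 3 / 3) +
        (16 + 16 * Real.pi - 12 * Real.pi * Real.sqrt 3)) := (ENNReal.ofReal_add hcap0 hm0).symm

/-- **Lower shell envelope.** For every frame `X`, unit `n` and `0 ≤ q ≤ √3`:
`|W(X) ∩ {q < ⟪y,n⟫}| ≥ cap₂(q) − π(64/3 − 12√3)` (the inner ball cap `cap_{√3}(q)` plus at least
half of [the mass `≥ π(20√3 − 32)` of `W(X)` in the shell `B̄(0,2) ∖ B̄(0,√3)` minus the shell band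
`{|⟪y,n⟫| ≤ q}`]). -/
theorem volume_cruxWulffBody_cap_ge_shell (X : E3 ≃ₗᵢ[ℝ] E3) {n : E3} (hn : ‖n‖ = 1) {q : ℝ}
    (hq0 : 0 ≤ q) (hq3 : q ≤ Real.sqrt 3) :
    ENNReal.ofReal (Real.pi * (16 / 3 - 4 * q + q ^ 3 / 3) - Real.pi * (64 / 3 - 12 * Real.sqrt 3)) ≤
      volume ({y : E3 | ∀ ν : E3, ⟪y, ν⟫_ℝ ≤ Real.sqrt 2 / 4 *
        ∑ᶠ w ∈ {w | w ∈ fccStacking 1 (Real.sqrt (2 / 3)) ∧ ‖w‖ = 1}, |⟪w, X.symm ν⟫_ℝ|} ∩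
        {y : E3 | q < ⟪y, n⟫_ℝ}) := by
  set body : Set E3 := {y : E3 | ∀ ν : E3, ⟪y, ν⟫_ℝ ≤ Real.sqrt 2 / 4 *
    ∑ᶠ w ∈ {w | w ∈ fccStacking 1 (Real.sqrt (2 / 3)) ∧ ‖w‖ = 1}, |⟪w, X.symm ν⟫_ℝ|} with hbody
  have hWm : MeasurableSet body := (isCompact_cruxWulffBody X).isClosed.measurableSet
  have hWneg : -body = body := neg_cruxWulffBody_eq X
  have hWvol : volume body = ENNReal.ofReal 32 := volume_cruxWulffBody X
  have h3pos : 0 < Real.sqrt 3 := Real.sqrt_pos.2 (by norm_num)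
  have h3sq : Real.sqrt 3 ^ 2 = 3 := Real.sq_sqrt (by norm_num)
  have h3cube : Real.sqrt 3 ^ 3 = 3 * Real.sqrt 3 := by rw [pow_succ, h3sq]
  have h3le2 : Real.sqrt 3 ≤ 2 := by rw [Real.sqrt_le_left (by norm_num)]; norm_num
  set B2 : Set E3 := Metric.closedBall (0 : E3) 2 with hB2
  set B3 : Set E3 := Metric.closedBall (0 : E3) (Real.sqrt 3) with hB3
  have hB2m : MeasurableSet B2 := Metric.isClosed_closedBall.measurableSet
  have hB3m : MeasurableSet B3 := Metric.isClosed_closedBall.measurableSet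
  have hB3B2 : B3 ⊆ B2 := Metric.closedBall_subset_closedBall h3le2
  have hB3W : B3 ⊆ body := closedBall_subset_cruxWulffBody X
  set H : Set E3 := {y : E3 | q < ⟪y, n⟫_ℝ} with hH
  have hHm : MeasurableSet H := measurableSet_lt measurable_const (measurable_id.inner measurable_const)
  set D : Set E3 := {y : E3 | -q ≤ ⟪y, n⟫_ℝ ∧ ⟪y, n⟫_ℝ ≤ q} with hD
  have hDm : MeasurableSet D := by
    have hDeq : D = (fun y : E3 => ⟪y, n⟫_ℝ) ⁻¹' Set.Icc (-q) q := by
      ext y; simp [hD, Set.mem_Icc]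
    rw [hDeq]
    exact (measurable_id.inner measurable_const) measurableSet_Icc
  -- the shell piece `T`
  set T : Set E3 := (body ∩ B2) \ B3 with hT
  have hTm : MeasurableSet T := (hWm.inter hB2m).diff hB3m
  have hTneg : -T = T := by
    ext y
    simp only [hT, Set.mem_neg, mem_sdiff, mem_inter_iff, hB2, hB3, Metric.mem_closedBall,
      dist_zero_right, norm_neg]
    constructor
    · rintro ⟨⟨hy, hb⟩, hc⟩
      exact ⟨⟨by have h2 : y ∈ -body := hy; rwa [hWneg] at h2, hb⟩, hc⟩
    · rintro ⟨⟨hy, hb⟩, hc⟩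
      exact ⟨⟨by rw [← hWneg] at hy; exact hy, hb⟩, hc⟩
  -- finiteness
  have hfinW : ∀ s : Set E3, s ⊆ body → volume s ≠ ⊤ := fun s hs =>
    (lt_of_le_of_lt (measure_mono hs) (by rw [hWvol]; exact ENNReal.ofReal_lt_top)).ne
  have hfinB2 : ∀ s : Set E3, s ⊆ B2 → volume s ≠ ⊤ := fun s hs =>
    (lt_of_le_of_lt (measure_mono hs) (by
      rw [hB2, volume_closedBall_zero_E3 (by norm_num : (0:ℝ) ≤ 2)]; exact ENNReal.ofReal_lt_top)).ne
  -- (i) the cap contains the inner ball cap and the shell piece cap, disjointly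
  have hsub : (B3 ∩ H) ∪ (T ∩ H) ⊆ body ∩ H := by
    rintro y (⟨hy, hh⟩ | ⟨⟨⟨hy, -⟩, -⟩, hh⟩)
    · exact ⟨hB3W hy, hh⟩
    · exact ⟨hy, hh⟩
  have hdisj : Disjoint (B3 ∩ H) (T ∩ H) := by
    rw [Set.disjoint_left]
    rintro y ⟨hy, -⟩ ⟨⟨-, hy'⟩, -⟩
    exact hy' hy
  have h1 : volume (B3 ∩ H) + volume (T ∩ H) ≤ volume (body ∩ H) := by
    rw [← measure_union hdisj (hTm.inter hHm)]
    exact measure_mono hsub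
  -- (ii) the mass of the shell piece
  have hTvol : ENNReal.ofReal (Real.pi * (24 * Real.sqrt 3 - 32)) - ENNReal.ofReal (4 * Real.pi * Real.sqrt 3) ≤
      volume T := by
    have hB3vol : volume B3 = ENNReal.ofReal (4 * Real.pi * Real.sqrt 3) := by
      rw [hB3, volume_closedBall_zero_E3 h3pos.le, h3cube]; congr 1; ring
    have hB3sub : B3 ⊆ body ∩ B2 := fun y hy => ⟨hB3W hy, hB3B2 hy⟩
    rw [hT, measure_sdiff hB3sub hB3m.nullMeasurableSet (hfinB2 B3 hB3B2), hB3vol]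
    exact tsub_le_tsub_right (volume_cruxWulffBody_inter_closedBall_two_ge X) _
  -- (iii) symmetric splitting of `T`
  have h3 : volume T ≤ 2 * volume (T ∩ H) + volume (T ∩ D) :=
    volume_le_two_mul_add_band_of_symm hTneg n q
  -- (iv) the shell band
  have hband2 := volume_closedBall_band_add n (2 : ℝ) hq0
  have hband3 := volume_closedBall_band_add n (Real.sqrt 3) hq0
  have hcap2 : volume (B2 ∩ H) = ENNReal.ofReal (Real.pi * (2 * 2 ^ 3 / 3 - 2 ^ 2 * q + q ^ 3 / 3)) :=
    volume_closedBall_inter_ioi hn two_pos (by linarith) (by linarith)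
  have hcap3 : volume (B3 ∩ H) = ENNReal.ofReal (Real.pi * (2 * Real.sqrt 3 ^ 3 / 3 - Real.sqrt 3 ^ 2 * q + q ^ 3 / 3)) :=
    volume_closedBall_inter_ioi hn h3pos hq3 (by linarith)
  have hTD : volume (T ∩ D) ≤ volume (B2 ∩ D) - volume (B3 ∩ D) := by
    have hsub' : T ∩ D ⊆ (B2 ∩ D) \ (B3 ∩ D) := by
      rintro y ⟨⟨⟨-, hb2⟩, hb3⟩, hd⟩
      exact ⟨⟨hb2, hd⟩, fun h => hb3 h.1⟩
    refine (measure_mono hsub').trans ?_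
    rw [measure_sdiff (inter_subset_inter_left _ hB3B2) (hB3m.inter hDm).nullMeasurableSet
      (hfinB2 _ ((inter_subset_left).trans hB3B2))]
  -- (v) pass to real numbers
  have hvB2 : volume B2 = ENNReal.ofReal (Real.pi * (32 / 3)) := by
    rw [hB2, volume_closedBall_zero_E3 (by norm_num : (0:ℝ) ≤ 2)]; congr 1; ring
  have hvB3 : volume B3 = ENNReal.ofReal (4 * Real.pi * Real.sqrt 3) := by
    rw [hB3, volume_closedBall_zero_E3 h3pos.le, h3cube]; congr 1; ring
  -- name the real numbers
  have htW : volume (body ∩ H) ≠ ⊤ := hfinW _ inter_subset_left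
  have htT : volume (T ∩ H) ≠ ⊤ := hfinB2 _ (fun y hy => hy.1.1.2)
  have htT' : volume T ≠ ⊤ := hfinB2 _ (fun y hy => hy.1.2)
  have htTD : volume (T ∩ D) ≠ ⊤ := hfinB2 _ (fun y hy => hy.1.1.2)
  have htB2D : volume (B2 ∩ D) ≠ ⊤ := hfinB2 _ inter_subset_left
  have htB3D : volume (B3 ∩ D) ≠ ⊤ := hfinB2 _ ((inter_subset_left).trans hB3B2)
  have htB2H : volume (B2 ∩ H) ≠ ⊤ := hfinB2 _ inter_subset_left
  have htB3H : volume (B3 ∩ H) ≠ ⊤ := hfinB2 _ ((inter_subset_left).trans hB3B2)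
  set w := (volume (body ∩ H)).toReal with hw
  set a3 := (volume (B3 ∩ H)).toReal with ha3
  set a2 := (volume (B2 ∩ H)).toReal with ha2
  set vT := (volume T).toReal with hvT
  set vTH := (volume (T ∩ H)).toReal with hvTH
  set vTD := (volume (T ∩ D)).toReal with hvTD
  set d2 := (volume (B2 ∩ D)).toReal with hd2
  set d3 := (volume (B3 ∩ D)).toReal with hd3
  have hcap20 : 0 ≤ Real.pi * (16 / 3 - 4 * q + q ^ 3 / 3) := by
    have : 0 ≤ 16 / 3 - 4 * q + q ^ 3 / 3 := by nlinarith [sq_nonneg (2 - q)]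
    exact mul_nonneg Real.pi_pos.le this
  have hcap30 : 0 ≤ Real.pi * (2 * Real.sqrt 3 - 3 * q + q ^ 3 / 3) := by
    have : 0 ≤ 2 * Real.sqrt 3 - 3 * q + q ^ 3 / 3 := by
      nlinarith [sq_nonneg (Real.sqrt 3 - q), h3sq, hq0, hq3, h3pos]
    exact mul_nonneg Real.pi_pos.le this
  have ra2 : a2 = Real.pi * (16 / 3 - 4 * q + q ^ 3 / 3) := by
    rw [ha2, hcap2, ENNReal.toReal_ofReal (by convert hcap20 using 2; ring)]; ring
  have ra3 : a3 = Real.pi * (2 * Real.sqrt 3 - 3 * q + q ^ 3 / 3) := by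
    rw [ha3, hcap3, h3cube, h3sq, ENNReal.toReal_ofReal (by convert hcap30 using 2; ring)]; ring
  -- real forms of (i)–(iv)
  have r1 : a3 + vTH ≤ w := by
    have := ENNReal.toReal_mono htW h1
    rwa [ENNReal.toReal_add htB3H htT] at this
  have r2 : Real.pi * (24 * Real.sqrt 3 - 32) - 4 * Real.pi * Real.sqrt 3 ≤ vT := by
    have h0 : 0 ≤ Real.pi * (24 * Real.sqrt 3 - 32) - 4 * Real.pi * Real.sqrt 3 := by
      have h3lo : (1.732 : ℝ) < Real.sqrt 3 := by rw [Real.lt_sqrt (by norm_num)]; norm_num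
      nlinarith [Real.pi_pos]
    have := ENNReal.toReal_mono htT' hTvol
    rwa [← ENNReal.ofReal_sub _ (by positivity), ENNReal.toReal_ofReal h0] at this
  have r3 : vT ≤ 2 * vTH + vTD := by
    have := ENNReal.toReal_mono (ENNReal.add_ne_top.2 ⟨ENNReal.mul_ne_top ENNReal.ofNat_ne_top htT, htTD⟩) h3
    rwa [ENNReal.toReal_add (ENNReal.mul_ne_top ENNReal.ofNat_ne_top htT) htTD, ENNReal.toReal_mul,
      ENNReal.toReal_ofNat] at this
  have r4 : vTD ≤ d2 - d3 := by
    have hle : volume (B3 ∩ D) ≤ volume (B2 ∩ D) := measure_mono (inter_subset_inter_left _ hB3B2)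
    have := ENNReal.toReal_mono (ne_top_of_le_ne_top htB2D tsub_le_self) hTD
    rwa [ENNReal.toReal_sub_of_le hle htB2D] at this
  have r5 : d2 + 2 * a2 = Real.pi * (32 / 3) := by
    have := congrArg ENNReal.toReal hband2
    rwa [ENNReal.toReal_add htB2D (ENNReal.mul_ne_top ENNReal.ofNat_ne_top htB2H), ENNReal.toReal_mul,
      ENNReal.toReal_ofNat, hvB2, ENNReal.toReal_ofReal (by positivity)] at this
  have r6 : d3 + 2 * a3 = 4 * Real.pi * Real.sqrt 3 := by
    have := congrArg ENNReal.toReal hband3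
    rwa [ENNReal.toReal_add htB3D (ENNReal.mul_ne_top ENNReal.ofNat_ne_top htB3H), ENNReal.toReal_mul,
      ENNReal.toReal_ofNat, hvB3, ENNReal.toReal_ofReal (by positivity)] at this
  -- conclude
  have hfinal : Real.pi * (16 / 3 - 4 * q + q ^ 3 / 3) - Real.pi * (64 / 3 - 12 * Real.sqrt 3) ≤ w := by
    nlinarith [r1, r2, r3, r4, r5, r6, ra2, ra3]
  calc ENNReal.ofReal (Real.pi * (16 / 3 - 4 * q + q ^ 3 / 3) - Real.pi * (64 / 3 - 12 * Real.sqrt 3))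
      ≤ ENNReal.ofReal w := ENNReal.ofReal_le_ofReal hfinal
    _ = volume (body ∩ H) := ENNReal.ofReal_toReal htW

end Summit.Ventures.Crystal3D.Theorems

end
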